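import Summits.ABC.StewartYu.PadicW80ParB
import HarnessLib

/-!
# The envelope of the `p`-adic parameter `U` (cell `abc-stewartyu`, WP-A5 closing)

`Summits/ABC/StewartYu/PadicW80ParEnvelope.lean` — theorems (and one real constant `Cw`) on the
record `PadicW80Par` of `PadicW80Par.lean`/`PadicW80ParB.lean` (cell HOME
`run/shared/lean/pub/abc-stewartyu/`, seat p2): the parameter `U = Aᵐ m^{2m+1}/m! (∏Vⱼ)V_θ W⋆ G` against the
shape of the `p`-adic Theorem A, `U ≤ (2⁶⁹ m)ᵐ · (∏Vⱼ)V_θ · (W + log 2V_max) · log(2V_max)` — the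
twin of `W80Par.U_le_Cw` (`Waldschmidt1980HW2.lean`) with both logarithmic terms at `V_max`
(`W⋆ ≤ m(10 + log m)(W + log 2V_max)`, `G ≤ m(17.1 + 1.45 log m) log(2V_max)`,
`m^{2m+1}/m! ≤ eᵐ m^{m+1}`).  It is the hypothesis `U ≤ Cw(d+1)·((∏V)·V_θ)·(W + log 2V_max)·log 2V_max`
of p2's closing adapter `PadicCW77.theoremAShapeLe_of_packs` with `Cw m = (2⁶⁹ m)ᵐ`.

## References
* [Waldschmidt1980] M. Waldschmidt, Acta Arith. 37 (1980), §3.1 (p. 264).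
* [Yu1990] K. Yu, Compositio Math. 74 (1990), Theorem 1 (the shape of the bound).
-/

noncomputable section

open Finset Real

namespace Summit.ABC.StewartYu

open Literature.NumberTheory.Transcendental

namespace PadicW80Par

variable {d : ℕ} (P : PadicW80Par d)

/-- **`U ≤ (2⁶⁹ m)ᵐ · (∏Vⱼ)V_θ · (W + log(2V_max)) · log(2V_max)`**: the parameter `U` of the
`p`-adic machine against the shape of Theorem A (`W⋆ ≤ m(10 + log m)(W + log 2V_max)`,
`G ≤ m(17.1 + 1.45 log m) log(2V_max)`, `m^{2m+1}/m! ≤ eᵐ m^{m+1}`).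
[cite: Waldschmidt1980, §3.1 (p. 264)] [cite: Yu1990, Theorem 1] -/
theorem U_le_Cw :
    P.Up ≤ (2 ^ 69 * mRp d) ^ (d + 1) * ((∏ j, P.Vs j) * P.Vel) * (P.Wb + Real.log (2 * P.Vmax)) *
      Real.log (2 * P.Vmax) := by
  have hm := two_le_mR P; have hm0 := mR_pos P; have hW := P.hW; have hVθ := P.one_le_Vθ
  have hVf := P.one_le_Vmax
  have hV := P.one_le_prodV
  set L := Real.log (2 * P.Vmax) with hL
  have hl2 := Real.log_two_gt_d9; have hl2' := Real.log_two_lt_d9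
  have hL2 : Real.log 2 ≤ L := by rw [hL]; exact Real.log_le_log two_pos (by linarith)
  have hL0 : 0 < L := by linarith
  have hlogm : 0 ≤ Real.log (mRp d) := Real.log_nonneg (by linarith)
  have hlogm' : Real.log (mRp d) ≤ mRp d := (Real.log_le_sub_one_of_pos hm0).trans (by linarith)
  -- `W⋆ ≤ m (10 + log m) (W + L)`
  have hWs : P.Wstarp ≤ mRp d * (10 + Real.log (mRp d)) * (P.Wb + L) := by
    unfold Wstarp
    refine max_le ?_ ?_
    · have h1 : (1 : ℝ) * 1 * P.Wb ≤ mRp d * (10 + Real.log (mRp d)) * (P.Wb + L) := by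
        gcongr
        · linarith
        · linarith
        · linarith
      linarith
    · have e : Real.log (2 ^ 13 * mRp d * P.Vmax) = 12 * Real.log 2 + Real.log (mRp d) + L := by
        rw [hL, Real.log_mul (by positivity) (by linarith), Real.log_mul (by positivity) hm0.ne',
          Real.log_mul two_ne_zero (by linarith), Real.log_pow]; push_cast; ring
      rw [e]
      have h2 : 12 * Real.log 2 + Real.log (mRp d) + L ≤ (10 + Real.log (mRp d)) * (P.Wb + L) := by
        nlinarith
      calc mRp d * (12 * Real.log 2 + Real.log (mRp d) + L) ≤ mRp d * ((10 + Real.log (mRp d)) * (P.Wb + L)) :=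
            mul_le_mul_of_nonneg_left h2 hm0.le
        _ = mRp d * (10 + Real.log (mRp d)) * (P.Wb + L) := by ring
  -- `G ≤ m (17.1 + 1.45 log m) L`
  have hG : P.Gp ≤ mRp d * (17.1 + 1.45 * Real.log (mRp d)) * L := by
    unfold Gp
    have e : Real.log (2 ^ 17 * mRp d * P.Vmax) = 16 * Real.log 2 + Real.log (mRp d) + L := by
      rw [hL, Real.log_mul (by positivity) (by linarith), Real.log_mul (by positivity) hm0.ne',
        Real.log_mul two_ne_zero (by linarith), Real.log_pow]; push_cast; ring
    rw [e]
    have h2 : 16 * Real.log 2 + Real.log (mRp d) + L ≤ (17.1 + 1.45 * Real.log (mRp d)) * L := by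
      nlinarith
    calc mRp d * (16 * Real.log 2 + Real.log (mRp d) + L) ≤ mRp d * ((17.1 + 1.45 * Real.log (mRp d)) * L) :=
          mul_le_mul_of_nonneg_left h2 hm0.le
      _ = _ := by ring
  -- `m^{2m+1}/m! ≤ e^m m^{m+1}`
  have hfac : mRp d ^ (2 * d + 3) / (d + 1).factorial ≤ Real.exp 1 ^ (d + 1) * mRp d ^ (d + 2) := by
    have hfacpos : (0 : ℝ) < (d + 1).factorial := by exact_mod_cast Nat.factorial_pos _
    have hst := CW77.pow_self_le_exp_mul_factorial (d + 1)
    have em : ((d + 1 : ℕ) : ℝ) = mRp d := by unfold mRp; push_cast; ring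
    rw [em] at hst
    rw [div_le_iff₀ hfacpos]
    calc mRp d ^ (2 * d + 3) = mRp d ^ (d + 2) * mRp d ^ (d + 1) := by rw [← pow_add]; ring_nf
      _ ≤ mRp d ^ (d + 2) * (Real.exp 1 ^ (d + 1) * (d + 1).factorial) := mul_le_mul_of_nonneg_left hst (by positivity)
      _ = Real.exp 1 ^ (d + 1) * mRp d ^ (d + 2) * (d + 1).factorial := by ring
  -- the constants: `A^m e^m m^{m+1} · m (10 + log m) · m (17.1 + 1.45 log m) ≤ (2^69 m)^m`
  have hconst : Ap ^ (d + 1) * (Real.exp 1 ^ (d + 1) * mRp d ^ (d + 2)) * (mRp d * (10 + Real.log (mRp d))) *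
      (mRp d * (17.1 + 1.45 * Real.log (mRp d))) ≤ (2 ^ 69 * mRp d) ^ (d + 1) := by
    have h1 : (10 + Real.log (mRp d)) * (17.1 + 1.45 * Real.log (mRp d)) ≤ 204.1 * mRp d ^ 2 := by nlinarith
    have h2 : mRp d ^ 5 ≤ 120 * Real.exp (mRp d) := by
      have := Real.pow_div_factorial_le_exp (mRp d) hm0.le 5
      rw [show (Nat.factorial 5 : ℝ) = 120 by norm_num, div_le_iff₀ (by norm_num)] at this
      linarith
    have he : Real.exp 1 ^ (d + 1) = Real.exp (mRp d) := by rw [← Real.exp_nat_mul]; unfold mRp; push_cast; ring_nf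
    have hexp1 := Real.exp_one_lt_d9
    have h3 : Ap ^ (d + 1) * (Real.exp 1 ^ (d + 1) * mRp d ^ (d + 2)) * (mRp d * (10 + Real.log (mRp d))) *
        (mRp d * (17.1 + 1.45 * Real.log (mRp d))) ≤ 204.1 * 120 * (Ap ^ (d + 1) * Real.exp (mRp d) ^ 2 * mRp d ^ (d + 1)) := by
      have hA : (0 : ℝ) ≤ Ap ^ (d + 1) := by unfold Ap; positivity
      calc Ap ^ (d + 1) * (Real.exp 1 ^ (d + 1) * mRp d ^ (d + 2)) * (mRp d * (10 + Real.log (mRp d))) *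
            (mRp d * (17.1 + 1.45 * Real.log (mRp d)))
          = Ap ^ (d + 1) * Real.exp (mRp d) * mRp d ^ (d + 1) * mRp d ^ 3 *
              ((10 + Real.log (mRp d)) * (17.1 + 1.45 * Real.log (mRp d))) := by rw [he]; ring
        _ ≤ Ap ^ (d + 1) * Real.exp (mRp d) * mRp d ^ (d + 1) * mRp d ^ 3 * (204.1 * mRp d ^ 2) := by
            gcongr
        _ = 204.1 * (Ap ^ (d + 1) * Real.exp (mRp d) * mRp d ^ (d + 1)) * mRp d ^ 5 := by ring
        _ ≤ 204.1 * (Ap ^ (d + 1) * Real.exp (mRp d) * mRp d ^ (d + 1)) * (120 * Real.exp (mRp d)) := by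
            gcongr
        _ = 204.1 * 120 * (Ap ^ (d + 1) * Real.exp (mRp d) ^ 2 * mRp d ^ (d + 1)) := by ring
    refine h3.trans ?_
    have he2 : Real.exp (mRp d) ^ 2 = Real.exp 2 ^ (d + 1) := by
      rw [← Real.exp_nat_mul, ← Real.exp_nat_mul]; unfold mRp; push_cast; ring_nf
    have he74 : Real.exp 2 ≤ 7.4 := by
      have : Real.exp 2 = Real.exp 1 ^ 2 := by rw [← Real.exp_nat_mul]; norm_num
      rw [this]; nlinarith [Real.exp_pos 1]
    have h4 : (204.1 : ℝ) * 120 * Real.exp 2 ^ (d + 1) ≤ (2 ^ 19) ^ (d + 1) := by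
      calc (204.1 : ℝ) * 120 * Real.exp 2 ^ (d + 1) ≤ (204.1 * 120) ^ (d + 1) * Real.exp 2 ^ (d + 1) := by
            gcongr
            have : (1 : ℝ) ≤ 204.1 * 120 := by norm_num
            calc (204.1 : ℝ) * 120 = (204.1 * 120) ^ 1 := (pow_one _).symm
              _ ≤ (204.1 * 120) ^ (d + 1) := pow_le_pow_right₀ this (by omega)
        _ = (204.1 * 120 * Real.exp 2) ^ (d + 1) := by ring
        _ ≤ (2 ^ 19) ^ (d + 1) := by
            apply pow_le_pow_left₀ (by positivity)
            nlinarith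
    unfold Ap
    calc 204.1 * 120 * (((2 : ℝ) ^ 50) ^ (d + 1) * Real.exp (mRp d) ^ 2 * mRp d ^ (d + 1))
        = (204.1 * 120 * Real.exp 2 ^ (d + 1)) * (((2 : ℝ) ^ 50) ^ (d + 1) * mRp d ^ (d + 1)) := by rw [he2]; ring
      _ ≤ (2 ^ 19) ^ (d + 1) * (((2 : ℝ) ^ 50) ^ (d + 1) * mRp d ^ (d + 1)) := by gcongr
      _ = (2 ^ 69 * mRp d) ^ (d + 1) := by
          rw [mul_pow, ← mul_assoc, ← pow_mul, ← pow_mul, ← pow_add, ← pow_mul,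
            show 19 * (d + 1) + 50 * (d + 1) = 69 * (d + 1) by ring]
  -- assemble
  unfold Up
  have hVV : 0 ≤ (∏ j, P.Vs j) * P.Vel := by positivity
  have hA : (0 : ℝ) ≤ Ap ^ (d + 1) := by unfold Ap; positivity
  have hG0 := P.G_pos.le; have hWs0 : 0 ≤ P.Wstarp := by linarith [P.one_le_Wstar]
  have hF0 : 0 ≤ mRp d ^ (2 * d + 3) / ((d + 1).factorial : ℝ) := by positivity
  have step1 : Ap ^ (d + 1) * (mRp d ^ (2 * d + 3) / (d + 1).factorial) * ((∏ j, P.Vs j) * P.Vel) * P.Wstarp * P.Gp ≤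
      Ap ^ (d + 1) * (Real.exp 1 ^ (d + 1) * mRp d ^ (d + 2)) * ((∏ j, P.Vs j) * P.Vel) *
          (mRp d * (10 + Real.log (mRp d)) * (P.Wb + L)) * (mRp d * (17.1 + 1.45 * Real.log (mRp d)) * L) := by
    have hc1 : 0 ≤ Ap ^ (d + 1) * (Real.exp 1 ^ (d + 1) * mRp d ^ (d + 2)) * ((∏ j, P.Vs j) * P.Vel) :=
      mul_nonneg (mul_nonneg hA (by positivity)) hVV
    have hc2 : 0 ≤ mRp d * (10 + Real.log (mRp d)) * (P.Wb + L) :=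
      mul_nonneg (mul_nonneg hm0.le (by linarith)) (by linarith)
    refine mul_le_mul (mul_le_mul (mul_le_mul_of_nonneg_right (mul_le_mul_of_nonneg_left hfac hA) hVV) hWs hWs0
      hc1) hG hG0 (mul_nonneg hc1 hc2)
  refine step1.trans ?_
  have e : Ap ^ (d + 1) * (Real.exp 1 ^ (d + 1) * mRp d ^ (d + 2)) * ((∏ j, P.Vs j) * P.Vel) *
      (mRp d * (10 + Real.log (mRp d)) * (P.Wb + L)) * (mRp d * (17.1 + 1.45 * Real.log (mRp d)) * L) =
      (Ap ^ (d + 1) * (Real.exp 1 ^ (d + 1) * mRp d ^ (d + 2)) * (mRp d * (10 + Real.log (mRp d))) *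
        (mRp d * (17.1 + 1.45 * Real.log (mRp d)))) * (((∏ j, P.Vs j) * P.Vel) * (P.Wb + L) * L) := by ring
  rw [e]
  have h0 : 0 ≤ ((∏ j, P.Vs j) * P.Vel) * (P.Wb + L) * L := by
    have : 0 ≤ P.Wb + L := by linarith
    positivity
  calc (Ap ^ (d + 1) * (Real.exp 1 ^ (d + 1) * mRp d ^ (d + 2)) * (mRp d * (10 + Real.log (mRp d))) *
        (mRp d * (17.1 + 1.45 * Real.log (mRp d)))) * (((∏ j, P.Vs j) * P.Vel) * (P.Wb + L) * L)
      ≤ (2 ^ 69 * mRp d) ^ (d + 1) * (((∏ j, P.Vs j) * P.Vel) * (P.Wb + L) * L) := mul_le_mul_of_nonneg_right hconst h0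
    _ = (2 ^ 69 * mRp d) ^ (d + 1) * ((∏ j, P.Vs j) * P.Vel) * (P.Wb + L) * L := by ring

/-- The envelope constant of Theorem A: `Cw m = (2⁶⁹ m)ᵐ`. [cite: Waldschmidt1980, §3.1 (p. 264)] -/
def Cw (m : ℕ) : ℝ := (2 ^ 69 * m) ^ m

/-- `Cw (d+1) = (2⁶⁹ m)^{d+1}` with `m = mRp d`. [cite: Waldschmidt1980, §3.1 (p. 264)] -/
theorem Cw_succ (d : ℕ) : Cw (d + 1) = (2 ^ 69 * mRp d) ^ (d + 1) := by
  unfold Cw mRp; push_cast; ring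

/-- `2 ≤ Cw m` for `m ≥ 1`. [cite: Waldschmidt1980, §3.1 (p. 264)] -/
theorem two_le_Cw {m : ℕ} (hm : 1 ≤ m) : (2 : ℝ) ≤ Cw m := by
  unfold Cw
  have h1 : (2 : ℝ) ≤ 2 ^ 69 * m := by
    have : (1 : ℝ) ≤ m := by exact_mod_cast hm
    nlinarith
  calc (2 : ℝ) = 2 ^ 1 := by norm_num
    _ ≤ (2 ^ 69 * (m : ℝ)) ^ 1 := by rw [pow_one, pow_one]; exact h1
    _ ≤ (2 ^ 69 * (m : ℝ)) ^ m := pow_le_pow_right₀ (by linarith) hm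

/-- The W80-type envelope: `2 · Cw m ≤ (2⁷⁰)^m · m^{1·m}` for `m ≥ 1`. [cite: Waldschmidt1980, §3.1 (p. 264)] -/
theorem two_mul_Cw_le {m : ℕ} (hm : 1 ≤ m) : 2 * Cw m ≤ (2 ^ 70 : ℝ) ^ m * (m : ℝ) ^ ((1 : ℝ) * m) := by
  unfold Cw
  rw [one_mul, Real.rpow_natCast, mul_pow]
  have hm0 : (0 : ℝ) ≤ (m : ℝ) ^ m := by positivity
  have h2 : (2 : ℝ) * (2 ^ 69) ^ m ≤ (2 ^ 70) ^ m := by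
    rw [← pow_mul, ← pow_mul]
    calc (2 : ℝ) * 2 ^ (69 * m) = 2 ^ (69 * m + 1) := by rw [pow_succ]; ring
      _ ≤ 2 ^ (70 * m) := pow_le_pow_right₀ (by norm_num) (by omega)
  calc 2 * (((2 : ℝ) ^ 69) ^ m * (m : ℝ) ^ m) = (2 * ((2 : ℝ) ^ 69) ^ m) * (m : ℝ) ^ m := by ring
    _ ≤ (2 ^ 70) ^ m * (m : ℝ) ^ m := mul_le_mul_of_nonneg_right h2 hm0

/-- `U ≤ Cw(d+1) · ((∏Vⱼ)·V_θ) · (W + log 2V_max) · log(2V_max)` — the envelope hypothesis of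
`PadicCW77.theoremAShapeLe_of_packs`. [cite: Waldschmidt1980, §3.1 (p. 264)] [cite: Yu1990, Theorem 1] -/
theorem U_le_Cw' :
    P.Up ≤ Cw (d + 1) * ((∏ j, P.Vs j) * P.Vel) * (P.Wb + Real.log (2 * P.Vmax)) * Real.log (2 * P.Vmax) := by
  rw [Cw_succ]; exact P.U_le_Cw

/-- `V_θ ≤ U` (so `log p ≤ V_θ` gives the floor `log p ≤ U` of the machine, N-U).
[cite: Waldschmidt1980, §3.1 (p. 264)] -/
theorem Vel_le_U : P.Vel ≤ P.Up := by
  have h1 := P.sumV_le_𝔘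
  have h2 := P.U_eq
  have hs : 0 ≤ ∑ j, P.Vs j := sum_nonneg fun j _ => le_trans zero_le_one (P.hV j)
  have h𝔘 := P.𝔘_pos
  have h3 : P.𝔘p ≤ P.Up := by
    rw [h2]
    have : (1 : ℝ) ≤ 2 ^ (d + 1) := one_le_pow₀ (by norm_num)
    nlinarith
  have h4 : P.Vel ≤ 2 ^ 90 * ((∑ j, P.Vs j) + P.Vel) := by
    have : (1 : ℝ) ≤ 2 ^ 90 := by norm_num
    nlinarith [P.one_le_Vθ]
  linarith

/-- N-U: `log p ≤ U` as soon as `log p ≤ V_θ`. [cite: Waldschmidt1980, §3.1 (p. 264)] -/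
theorem le_U_of_le_Vθ {x : ℝ} (hx : x ≤ P.Vel) : x ≤ P.Up := hx.trans P.Vel_le_U

end PadicW80Par

end Summit.ABC.StewartYu

end
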